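import Summits.BirchSwinnertonDyer.BirchSwinnertonDyer.Theorems.EisensteinPrimesAcTwistDeformationDualBasis
import Literature.NumberTheory.EllipticCurves.TateModulePontryaginDualCharpolyProofs
import Literature.NumberTheory.EllipticCurves.TateModuleFinrankProofs
import HarnessLib

/-!
# Route `EisensteinPrimes` (rung K5), crux 2 `GoodLatticeBDPValue`, line `halves` v19.1, V21 index road
# input S2 (SUR_f at `v̄`) — the instance, part 1: `Hom(E[p^∞], ℚ/ℤ) ≅ ℤ_p²` and RANK-2 DUAL-BASIS
# FAMILIES for `E[p^∞] = PrimaryTorsion W.geomPoints p` over `ℚ/ℤ` and over `K̄ˣ`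
# (helper for stmt-BirchSwinnertonDyer-19032)

Cell `bsd-eis` (home `run/shared/lean/pub/bsd-eis/`), seat `bsd-line-x1-p1-w3` gen 3 (D-0154 width seat
on crux 2 `GoodLatticeBDPValue`, line `halves` v19.1; LEAD g4's V21 index road §4 S2, curve side). The
seat's arena (`…CofreeRank`, `…SURRank`, `…LOC1Rank`, `…DualBasis`) is written for an `A` with dual-basis
FAMILIES `Fin n → Hom(A, C)` (`C = ℚ/ℤ`, `K̄ˣ`) and, for `h⁰ = 0` / LOC⁽¹⁾, a rank-TWO Pontryagin basis
(Cayley–Hamilton `2 × 2`). THIS FILE produces them for `A = E[p^∞]` from the tree: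

* §1 **`finrank_characterModule_primaryTorsion`** — `rank_{ℤ_p} Hom(E[p^∞], ℚ/ℤ) = 2` for an elliptic
  curve over a field of characteristic `0`: the character module is finite free (cell `bsd-ssimc`,
  `SignedBaseChangeAcDivCofree.module_free/finite_characterModule_primaryTorsion`), its rank is the rank
  of the Tate module `T_p(E[p^∞])` (`TateModule.finrank_quotientTorsion_characterModule_eq_finrank_tateModule`,
  cell `bsd-stepL`), `T_p(E[p^∞]) ≅ T_p E` (`TateModule.exists_linearEquiv_primaryTorsion`) and
  `rank T_p E = 2` (`finrank_tateModule_eq_two_holds`, Silverman III.7.1).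
* §2 **`exists_dualBases_primaryTorsion`** — `E[p^∞]` is `p`-primary and carries dual-basis families
  `jQ : Fin 2 → Hom(E[p^∞], ℚ/ℤ)` and `jU : Fin 2 → Hom(E[p^∞], K̄ˣ)` with `hinj`/`hsurj`
  (`Module.finBasisOfFinrankEq` on the character module; the `K̄ˣ`-valued dual datum ON THE SAME
  character module is `SignedBaseChangeAcDivCofree.exists_isDualPairing_characterModule_of_injective`;
  families by `dualBasis_hinj_hsurj`).

Theorems only; no definition, no named fact, no `sorry`. HONEST FRAMING: instance bookkeeping; closes
nothing by itself (`--supports`); no summit statement / BSD / IMC2 / KY Thm. 1.4.1 (iii) is proved by this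
file. References: [SilvermanAEC2009] Prop. III.7.1 (a), Cor. III.6.4 (b), §VIII.2; [Greenberg2006] p. 338
L15–19 (`T* = Hom(D, μ_{p^∞})` free of rank `n`); [GreenbergLNM1716] §3 (proof of Lemma 3.3).
-/

set_option autoImplicit false
set_option linter.dupNamespace false

noncomputable section

open scoped Classical
open Literature.NumberTheory.EllipticCurves Literature.NumberTheory.IwasawaTheory
  Literature.NumberTheory.IwasawaTheory.Greenberg2016 Literature.NumberTheory.GaloisRepresentations
  Summit.BirchSwinnertonDyer.BirchSwinnertonDyer.Theorems.SignedBaseChangeAcDivCofree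

namespace Summit.BirchSwinnertonDyer.BirchSwinnertonDyer.Theorems.AcTwistDeformation

section Curve

variable {F : Type} [Field F] [CharZero F] (W : WeierstrassCurve F) [W.IsElliptic] (p : ℕ) [hp : Fact p.Prime]

/-! ## §1 `rank_{ℤ_p} Hom(E[p^∞], ℚ/ℤ) = 2` -/

/-- **`Hom(E[p^∞], ℚ/ℤ)` is free of rank TWO over `ℤ_p`** (`E/F` elliptic, `char F = 0`): its rank is the
rank of `T_p(E[p^∞]) ≅ T_p E`, which is `2`. [cite: SilvermanAEC2009, Prop. III.7.1 (a)]
[cite: GreenbergLNM1716, §3, proof of Lemma 3.3 (B_v ≅ (ℚ_p/ℤ_p)^e × finite)] -/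
theorem finrank_characterModule_primaryTorsion :
    Module.finrank ℤ_[p] (CharacterModule (PrimaryTorsion W.geomPoints p)) = 2 := by
  haveI := module_finite_characterModule_primaryTorsion W p
  haveI := module_free_characterModule_primaryTorsion W p
  haveI : Module.Finite ℤ_[p] (TateModule (PrimaryTorsion W.geomPoints p) p) :=
    TateModule.module_finite_of_module_finite_characterModule
  haveI : Module.Free ℤ_[p] (TateModule (PrimaryTorsion W.geomPoints p) p) :=
    TateModule.module_free_of_module_finite_characterModule
  obtain ⟨P, hP⟩ := TateModule.exists_pairing (PrimaryTorsion W.geomPoints p) p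
  have h1 := TateModule.finrank_quotientTorsion_characterModule_eq_finrank_tateModule hP
    (primaryTorsion_exists_pow_nsmul_eq_zero W p)
  -- `T_p(E[p^∞]) ≅ T_p E`, of rank `2`
  obtain ⟨e, -⟩ := TateModule.exists_linearEquiv_primaryTorsion W.geomPoints p
  have hp0 : (p : F) ≠ 0 := Nat.cast_ne_zero.mpr hp.out.ne_zero
  have h2 : Module.finrank ℤ_[p] (TateModule (PrimaryTorsion W.geomPoints p) p) = 2 := by
    rw [e.finrank_eq]
    exact WeierstrassCurve.finrank_tateModule_eq_two_holds W p hp0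
  -- the character module is torsion-free: quotient by torsion is the module
  have htors : Submodule.torsion ℤ_[p] (CharacterModule (PrimaryTorsion W.geomPoints p)) = ⊥ :=
    Submodule.isTorsionFree_iff_torsion_eq_bot.mp (isTorsionFree_characterModule_primaryTorsion W p)
  rw [← (Submodule.quotEquivOfEqBot _ htors).finrank_eq, h1, h2]

/-! ## §2 The two rank-2 dual-basis families of `E[p^∞]` -/

/-- **RANK-2 DUAL-BASIS FAMILIES FOR `E[p^∞]`** over `ℚ/ℤ` (Pontryagin) and over `K̄ˣ = F̄ˣ` (Tate): `E[p^∞]`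
is `p`-primary and there are `jQ : Fin 2 → Hom(E[p^∞], ℚ/ℤ)`, `jU : Fin 2 → Hom(E[p^∞], F̄ˣ)` through which
`ℤ_p² ≅ Hom(E[p^∞], ℚ/ℤ)` and `ℤ_p² ≅ Hom(E[p^∞], F̄ˣ)` (`c ↦ Σ_k j_k ∘ (c_k • ·)` injective and onto) —
the inputs `hA, jQ, jU, hinj, hsurj` of the seat's corank-2 arena for `𝐃_E = E[p^∞] ⊗ Λ^*(κ⁻¹)`.
[cite: SilvermanAEC2009, Prop. III.7.1 (a)] [cite: Greenberg2006, p. 338 L15–19] -/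
theorem exists_dualBases_primaryTorsion :
    (∀ a : PrimaryTorsion W.geomPoints p, ∃ k : ℕ, p ^ k • a = 0) ∧
      ∃ (jQ : Fin 2 → (PrimaryTorsion W.geomPoints p →+ AddCircle (1 : ℚ)))
        (jU : Fin 2 → (PrimaryTorsion W.geomPoints p →+ DiscreteGaloisModule.UnitsCarrier F)),
        (∀ c : Fin 2 → ℤ_[p], (∀ a, ∑ k, jQ k (c k • a) = 0) → c = 0) ∧
        (∀ φ : PrimaryTorsion W.geomPoints p →+ AddCircle (1 : ℚ), ∃ c : Fin 2 → ℤ_[p],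
          ∀ a, φ a = ∑ k, jQ k (c k • a)) ∧
        (∀ c : Fin 2 → ℤ_[p], (∀ a, ∑ k, jU k (c k • a) = 0) → c = 0) ∧
        (∀ φ : PrimaryTorsion W.geomPoints p →+ DiscreteGaloisModule.UnitsCarrier F, ∃ c : Fin 2 → ℤ_[p],
          ∀ a, φ a = ∑ k, jU k (c k • a)) := by
  have hA := primaryTorsion_exists_pow_nsmul_eq_zero W p
  haveI := module_finite_characterModule_primaryTorsion W p
  haveI := module_free_characterModule_primaryTorsion W p
  let b : Module.Basis (Fin 2) ℤ_[p] (CharacterModule (PrimaryTorsion W.geomPoints p)) :=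
    Module.finBasisOfFinrankEq ℤ_[p] _ (finrank_characterModule_primaryTorsion W p)
  -- the Pontryagin family
  obtain ⟨hinjQ, hsurjQ⟩ := dualBasis_hinj_hsurj
    (isDualPairing_characterModule ℤ_[p] (PrimaryTorsion W.geomPoints p)) b
  -- the Tate family, on the same character module
  haveI : CharZero (AlgebraicClosure F) :=
    charZero_of_injective_algebraMap (algebraMap F (AlgebraicClosure F)).injective
  haveI : NeZero (p : AlgebraicClosure F) := ⟨Nat.cast_ne_zero.mpr hp.out.ne_zero⟩
  obtain ⟨j, hj⟩ := QpModZp.exists_injective_units (p := p) (AlgebraicClosure F)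
  let jC : QpModZp p →+ DiscreteGaloisModule.UnitsCarrier F :=
    (DiscreteGaloisModule.UnitsCarrier.toAdditive (K := F)).symm.toAddMonoidHom.comp j
  have hjC : Function.Injective jC :=
    (DiscreteGaloisModule.UnitsCarrier.toAdditive (K := F)).symm.injective.comp hj
  obtain ⟨tA, htA⟩ := exists_isDualPairing_characterModule_of_injective hA hjC
    (QpModZp.unitsCarrier_torsionBound F)
  obtain ⟨hinjU, hsurjU⟩ := dualBasis_hinj_hsurj htA b
  exact ⟨hA, fun k ↦ (AddMonoidHom.id _) (b k), fun k ↦ tA (b k), hinjQ, hsurjQ, hinjU, hsurjU⟩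

end Curve

end Summit.BirchSwinnertonDyer.BirchSwinnertonDyer.Theorems.AcTwistDeformation

end
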